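import Summits.Schanuel.Schanuel.Theorems.SoloInformedX193Exceptional
import Summits.Schanuel.Schanuel.Theorems.SoloInformedX193Inequalities

/-!
# X193 kernel line, file F6b: exceptional columns of one level — the liquid columns

Solo seat `solo-Schanuel-informed`, X193 kernel programme (design note
`work/s213/X193-KERNEL-DESIGN.md`, Amendment A9; pen proof `work/s194/X193-pen.md` §6 (F1);
files F1 = `SoloInformedX193Inequalities`, F2 = `SoloInformedX193Service`,
F6a = `SoloInformedX193Exceptional`).

A column `k` is LIQUID at level `n` when it has no main server: every alive piece `P`
supplies `m_P d_P^k < λ n^ν`.  Pen §6 (F1) bounds the number of liquid active columns by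
summing the resultant inequality (PAIR) over ordered pairs of distinct alive pieces.  For
an abstract service structure `D : SoloServiceData ι` and a set `Lq ⊆ [1, K]`, `K ≤ n^σ`,
of liquid columns this file proves

  `|Lq| · 2 ((1-λ) n^ν - 2 c₀ n) ≤ 2 n (n^β + b₁ n) + 16 A₁ n³ log (K+2)`   (`liquid_count`)

in three steps: at one liquid column, with `Ak` = the alive pieces near-root at `k` with
positive bank and weights `w_P = m_P d_P^k`, (Srv) and (NRb) give `Σ_{Ak} w ≥ n^ν - 2 c₀ n`
and sorting (`soloX_two_mul_sub_le_sum_min`, `soloX_min_mul_le` of file F1) gives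
`2 ((1-λ) n^ν - 2 c₀ n) ≤ Σ_{P ≠ Q ∈ Ak} m_P m_Q min (d_P^k, d_Q^k)` (`liquid_column`); the
sums over columns and over ordered pairs are exchanged (`soloX_sum_pairs_comm`); and
(PAIR), with `|S| ≤ g_P` by (NRc) and the budgets `Σ m g ≤ n`, `Σ m L ≤ n^β + b₁ n`,
`Σ m g² ≤ n²`, `Σ m ≤ n`, bounds the sum over ordered pairs (`pair_sum_le`).
No sorries.
-/

namespace Summit.Schanuel.Schanuel.Theorems

open Finset

/-- Rearrangement behind (F1): summing, over ordered pairs `(P, Q)` of distinct elements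
of `A`, a function over the columns `k ∈ Lq` at which both `P` and `Q` satisfy `c`, is
the same as summing over the columns `k ∈ Lq` the function over ordered pairs of distinct
elements of `A` satisfying `c · k`. -/
theorem soloX_sum_pairs_comm {ι : Type*} [DecidableEq ι] (A : Finset ι) (Lq : Finset ℕ)
    (c : ι → ℕ → Prop) [∀ P k, Decidable (c P k)] (f : ι → ι → ℕ → ℝ) :
    ∑ P ∈ A, ∑ Q ∈ A.erase P, ∑ k ∈ Lq.filter (fun k => c P k ∧ c Q k), f P Q k =
      ∑ k ∈ Lq, ∑ P ∈ A.filter (fun P => c P k),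
        ∑ Q ∈ (A.filter (fun Q => c Q k)).erase P, f P Q k := by
  have h1 : ∀ P Q, ∑ k ∈ Lq.filter (fun k => c P k ∧ c Q k), f P Q k =
      ∑ k ∈ Lq, if c P k ∧ c Q k then f P Q k else 0 :=
    fun P Q => Finset.sum_filter _ _
  have h2 : ∀ P, ∑ Q ∈ A.erase P, ∑ k ∈ Lq, (if c P k ∧ c Q k then f P Q k else 0) =
      ∑ k ∈ Lq, ∑ Q ∈ A.erase P, (if c P k ∧ c Q k then f P Q k else 0) :=
    fun P => Finset.sum_comm
  simp_rw [h1, h2]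
  rw [Finset.sum_comm]
  refine Finset.sum_congr rfl fun k _ => ?_
  rw [Finset.sum_filter]
  refine Finset.sum_congr rfl fun P _ => ?_
  by_cases hP : c P k
  · rw [if_pos hP, ← Finset.filter_erase, Finset.sum_filter]
    refine Finset.sum_congr rfl fun Q _ => ?_
    simp [hP]
  · rw [if_neg hP]
    refine Finset.sum_eq_zero fun Q _ => ?_
    simp [hP]

namespace SoloServiceData

variable {ι : Type*} (D : SoloServiceData ι)

/-! ### (F1) the liquid columns -/

/-- (F1) at one LIQUID column `k` (active; every alive piece supplies `m_P d_P^k < λ n^ν`):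
let `Ak` be the alive pieces near-root at `k` with positive bank and `w_P = m_P d_P^k`;
(Srv) and (NRb) give `Σ_{Ak} w ≥ n^ν - 2 c₀ n`, sorting (file F1) gives
`2 (Σ w - λ n^ν) ≤ Σ_{P ≠ Q ∈ Ak} min (w_P, w_Q)`, and `min (w_P, w_Q) ≤ m_P m_Q min (d_P,
d_Q)`; so `2 ((1-λ) n^ν - 2 c₀ n) ≤ Σ_{P ≠ Q ∈ Ak} m_P m_Q min (d_P^k, d_Q^k)`. -/
theorem liquid_column [DecidableEq ι] {c₀ β b₁ σ ν lam : ℝ} {n₀ : ℕ}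
    (hW : D ∈ wellFormed c₀) (hc₀ : 0 ≤ c₀) (hB : D ∈ budgetLaw β b₁ n₀)
    (hS : D ∈ serviceLaw σ ν c₀ n₀) {n : ℕ} (hn : n₀ ≤ n)
    (hpos : 2 * c₀ * n < (n : ℝ) ^ ν) {k : ℕ} (hk1 : 1 ≤ k) (hk : (k : ℝ) ≤ (n : ℝ) ^ σ)
    (hliq : ∀ P ∈ D.alive n, (D.mult P n : ℝ) * D.bank P k < lam * (n : ℝ) ^ ν)
    (Ak : Finset ι)
    (hAk : ∀ P, P ∈ Ak ↔ P ∈ D.alive n ∧ (D.nearRoot P k = true ∧ 0 < D.bank P k)) :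
    2 * ((1 - lam) * (n : ℝ) ^ ν - 2 * c₀ * n) ≤
      ∑ P ∈ Ak, ∑ Q ∈ Ak.erase P,
        (D.mult P n : ℝ) * D.mult Q n * min (D.bank P k) (D.bank Q k) := by
  have hsub : Ak ⊆ D.alive n := fun P hP => ((hAk P).mp hP).1
  have hsrv := hS n hn k hk1 hk
  have hsd := Finset.sum_sdiff hsub (f := fun P => (D.mult P n : ℝ) * D.bank P k)
  have hrest : ∑ P ∈ D.alive n \ Ak, (D.mult P n : ℝ) * D.bank P k ≤ c₀ * n := by
    have hterm : ∀ P ∈ D.alive n \ Ak,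
        (D.mult P n : ℝ) * D.bank P k ≤ c₀ * ((D.mult P n : ℝ) * D.deg P) := by
      intro P hP
      obtain ⟨hPa, hPn⟩ := Finset.mem_sdiff.mp hP
      have hm : (0 : ℝ) ≤ D.mult P n := by positivity
      have hg : (0 : ℝ) ≤ D.deg P := by positivity
      by_cases hNR : D.nearRoot P k = true
      · have hd : D.bank P k ≤ 0 := by
          by_contra h
          exact hPn ((hAk P).mpr ⟨hPa, hNR, lt_of_not_ge h⟩)
        nlinarith [mul_nonneg hc₀ (mul_nonneg hm hg)]
      · have hd : D.bank P k ≤ c₀ * D.deg P := hW.2.2.2.1 P k (by simpa using hNR)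
        nlinarith
    calc ∑ P ∈ D.alive n \ Ak, (D.mult P n : ℝ) * D.bank P k
        ≤ ∑ P ∈ D.alive n \ Ak, c₀ * ((D.mult P n : ℝ) * D.deg P) :=
          Finset.sum_le_sum hterm
      _ ≤ ∑ P ∈ D.alive n, c₀ * ((D.mult P n : ℝ) * D.deg P) :=
          Finset.sum_le_sum_of_subset_of_nonneg Finset.sdiff_subset
            fun P _ _ => by positivity
      _ = c₀ * ∑ P ∈ D.alive n, (D.mult P n : ℝ) * D.deg P := by rw [Finset.mul_sum]
      _ ≤ c₀ * n := mul_le_mul_of_nonneg_left (hB n hn).1 hc₀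
  have hWk : (n : ℝ) ^ ν - 2 * c₀ * n ≤ ∑ P ∈ Ak, (D.mult P n : ℝ) * D.bank P k := by
    linarith [hsrv, hsd, hrest]
  have hw0 : ∀ P ∈ Ak, 0 ≤ (D.mult P n : ℝ) * D.bank P k := by
    intro P hP
    exact mul_nonneg (by positivity) ((hAk P).mp hP).2.2.le
  have hwM : ∀ P ∈ Ak, (D.mult P n : ℝ) * D.bank P k ≤ lam * (n : ℝ) ^ ν :=
    fun P hP => (hliq P (hsub hP)).le
  have hne : Ak.Nonempty := by
    rw [Finset.nonempty_iff_ne_empty]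
    intro h
    rw [h, Finset.sum_empty] at hWk
    linarith
  have hsort := soloX_two_mul_sub_le_sum_min Ak hne (fun P => (D.mult P n : ℝ) * D.bank P k)
    hw0 hwM
  have hmin : ∀ P ∈ Ak, ∀ Q ∈ Ak.erase P,
      min ((D.mult P n : ℝ) * D.bank P k) ((D.mult Q n : ℝ) * D.bank Q k) ≤
        (D.mult P n : ℝ) * D.mult Q n * min (D.bank P k) (D.bank Q k) := by
    intro P hP Q hQ
    have hP' := (hAk P).mp hP
    have hQ' := (hAk Q).mp (Finset.mem_of_mem_erase hQ)
    exact soloX_min_mul_le (D.one_le_mult_of_alive hW hP'.1)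
      (D.one_le_mult_of_alive hW hQ'.1) hP'.2.2.le hQ'.2.2.le
  calc 2 * ((1 - lam) * (n : ℝ) ^ ν - 2 * c₀ * n)
      ≤ 2 * ((∑ P ∈ Ak, (D.mult P n : ℝ) * D.bank P k) - lam * (n : ℝ) ^ ν) := by
        linarith
    _ ≤ _ := hsort
    _ ≤ _ := Finset.sum_le_sum fun P hP => Finset.sum_le_sum fun Q hQ => hmin P hP Q hQ

/-- (PAIR) summed over ordered pairs of distinct alive pieces with weights `m_P m_Q`, the
column sets `S P Q ⊆ [1, K]` consisting of near-root columns of `P` (so `|S P Q| ≤ g_P` by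
(NRc), and `(g_P + g_Q + |S|)² ≤ 8 (g_P² + g_Q²)`): with `Σ m g ≤ n`, `Σ m L ≤ n^β + b₁ n`,
`Σ m g² ≤ n²`, `Σ m ≤ n`, the total is at most `2 n (n^β + b₁ n) + 16 A₁ n³ log (K+2)`. -/
theorem pair_sum_le [DecidableEq ι] {c₀ β b₁ A₁ : ℝ} {n₀ : ℕ} (hW : D ∈ wellFormed c₀)
    (hB : D ∈ budgetLaw β b₁ n₀) (hP : D ∈ pairLaw A₁) (hA₁ : 0 ≤ A₁) {n : ℕ}
    (hn : n₀ ≤ n) (K : ℕ) (S : ι → ι → Finset ℕ)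
    (hS : ∀ P Q, ∀ k ∈ S P Q, 1 ≤ k ∧ k ≤ K)
    (hSnr : ∀ P Q, ∀ k ∈ S P Q, D.nearRoot P k = true) :
    ∑ P ∈ D.alive n, ∑ Q ∈ (D.alive n).erase P,
        (D.mult P n : ℝ) * D.mult Q n * ∑ k ∈ S P Q, min (D.bank P k) (D.bank Q k) ≤
      2 * n * ((n : ℝ) ^ β + b₁ * n) + 16 * A₁ * (n : ℝ) ^ 3 * Real.log ((K : ℝ) + 2) := by
  have hK0 : (0 : ℝ) ≤ K := by positivity
  have hlog : 0 ≤ Real.log ((K : ℝ) + 2) := Real.log_nonneg (by linarith)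
  have hg0 : ∀ P, (0 : ℝ) ≤ D.deg P := fun P => by positivity
  have hL0 : ∀ P, 0 ≤ D.logHt P := hW.2.1
  have hm0 : ∀ P, (0 : ℝ) ≤ D.mult P n := fun P => by positivity
  -- the bound for one ordered pair
  have hpair : ∀ P ∈ D.alive n, ∀ Q ∈ (D.alive n).erase P,
      (D.mult P n : ℝ) * D.mult Q n * ∑ k ∈ S P Q, min (D.bank P k) (D.bank Q k) ≤
        (D.mult P n : ℝ) * D.mult Q n *
          (D.deg Q * D.logHt P + D.deg P * D.logHt Q +
            8 * A₁ * ((D.deg P : ℝ) ^ 2 + (D.deg Q : ℝ) ^ 2) * Real.log ((K : ℝ) + 2)) := by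
    intro P _ Q hQ
    have hne : P ≠ Q := (Finset.ne_of_mem_erase hQ).symm
    have h1 := hP P Q hne K (S P Q) (hS P Q)
    have hcard : ((S P Q).card : ℝ) ≤ D.deg P := by
      exact_mod_cast hW.2.2.2.2 P (S P Q) (hSnr P Q)
    have hc0 : (0 : ℝ) ≤ (S P Q).card := by positivity
    have h3 : ((D.deg P : ℝ) + D.deg Q + (S P Q).card) ^ 2 ≤
        (2 * (D.deg P : ℝ) + D.deg Q) ^ 2 :=
      pow_le_pow_left₀ (by linarith [hg0 P, hg0 Q]) (by linarith) 2
    have h4 : (2 * (D.deg P : ℝ) + D.deg Q) ^ 2 ≤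
        8 * ((D.deg P : ℝ) ^ 2 + (D.deg Q : ℝ) ^ 2) := by
      nlinarith [sq_nonneg (2 * (D.deg P : ℝ) - D.deg Q), sq_nonneg (D.deg Q : ℝ)]
    have h5 : A₁ * ((D.deg P : ℝ) + D.deg Q + (S P Q).card) ^ 2 * Real.log ((K : ℝ) + 2) ≤
        8 * A₁ * ((D.deg P : ℝ) ^ 2 + (D.deg Q : ℝ) ^ 2) * Real.log ((K : ℝ) + 2) := by
      have h6 := mul_le_mul_of_nonneg_left (h3.trans h4) hA₁
      have h7 := mul_le_mul_of_nonneg_right h6 hlog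
      linarith [h7]
    exact mul_le_mul_of_nonneg_left (by linarith) (mul_nonneg (hm0 P) (hm0 Q))
  -- extend the inner sums from `erase P` to all alive pieces (nonnegative summands)
  have hnn : ∀ P Q, 0 ≤ (D.mult P n : ℝ) * D.mult Q n *
      (D.deg Q * D.logHt P + D.deg P * D.logHt Q +
        8 * A₁ * ((D.deg P : ℝ) ^ 2 + (D.deg Q : ℝ) ^ 2) * Real.log ((K : ℝ) + 2)) := by
    intro P Q
    have := hg0 P; have := hg0 Q; have := hL0 P; have := hL0 Q
    have := hm0 P; have := hm0 Q
    positivity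
  have hstep : ∑ P ∈ D.alive n, ∑ Q ∈ (D.alive n).erase P,
        (D.mult P n : ℝ) * D.mult Q n * ∑ k ∈ S P Q, min (D.bank P k) (D.bank Q k) ≤
      ∑ P ∈ D.alive n, ∑ Q ∈ D.alive n, (D.mult P n : ℝ) * D.mult Q n *
          (D.deg Q * D.logHt P + D.deg P * D.logHt Q +
            8 * A₁ * ((D.deg P : ℝ) ^ 2 + (D.deg Q : ℝ) ^ 2) * Real.log ((K : ℝ) + 2)) := by
    refine Finset.sum_le_sum fun P hPa => ?_
    exact (Finset.sum_le_sum fun Q hQ => hpair P hPa Q hQ).trans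
      (Finset.sum_le_sum_of_subset_of_nonneg (Finset.erase_subset _ _) fun Q _ _ => hnn P Q)
  -- evaluate the full double sum in terms of the four budget totals
  have hid : ∀ P Q, (D.mult P n : ℝ) * D.mult Q n *
      (D.deg Q * D.logHt P + D.deg P * D.logHt Q +
        8 * A₁ * ((D.deg P : ℝ) ^ 2 + (D.deg Q : ℝ) ^ 2) * Real.log ((K : ℝ) + 2)) =
      ((D.mult P n : ℝ) * D.logHt P) * ((D.mult Q n : ℝ) * D.deg Q) +
      ((D.mult P n : ℝ) * D.deg P) * ((D.mult Q n : ℝ) * D.logHt Q) +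
      (8 * A₁ * Real.log ((K : ℝ) + 2)) *
        (((D.mult P n : ℝ) * (D.deg P : ℝ) ^ 2) * (D.mult Q n : ℝ)) +
      (8 * A₁ * Real.log ((K : ℝ) + 2)) *
        ((D.mult P n : ℝ) * ((D.mult Q n : ℝ) * (D.deg Q : ℝ) ^ 2)) := by
    intro P Q; ring
  simp_rw [hid] at hstep
  simp only [Finset.sum_add_distrib, ← Finset.mul_sum, ← Finset.sum_mul] at hstep
  obtain ⟨hTg, hTL⟩ := hB n hn
  have hT1 := D.sum_mult_le_level hW hB hn
  have hT2 := D.sum_mult_deg_sq_le hW hB hn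
  have hn0 : (0 : ℝ) ≤ n := by positivity
  have hTg0 : 0 ≤ ∑ P ∈ D.alive n, (D.mult P n : ℝ) * D.deg P :=
    Finset.sum_nonneg fun P _ => mul_nonneg (hm0 P) (hg0 P)
  have hTL0 : 0 ≤ ∑ P ∈ D.alive n, (D.mult P n : ℝ) * D.logHt P :=
    Finset.sum_nonneg fun P _ => mul_nonneg (hm0 P) (hL0 P)
  have hT10 : 0 ≤ ∑ P ∈ D.alive n, (D.mult P n : ℝ) :=
    Finset.sum_nonneg fun P _ => hm0 P
  have hT20 : 0 ≤ ∑ P ∈ D.alive n, (D.mult P n : ℝ) * (D.deg P : ℝ) ^ 2 :=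
    Finset.sum_nonneg fun P _ => mul_nonneg (hm0 P) (by positivity)
  have hX0 : 0 ≤ (n : ℝ) ^ β + b₁ * n := le_trans hTL0 hTL
  have hA : (∑ P ∈ D.alive n, (D.mult P n : ℝ) * D.logHt P) *
      (∑ P ∈ D.alive n, (D.mult P n : ℝ) * D.deg P) ≤ ((n : ℝ) ^ β + b₁ * n) * n :=
    mul_le_mul hTL hTg hTg0 hX0
  have hB' : (∑ P ∈ D.alive n, (D.mult P n : ℝ) * (D.deg P : ℝ) ^ 2) *
      (∑ P ∈ D.alive n, (D.mult P n : ℝ)) ≤ (n : ℝ) ^ 2 * n :=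
    mul_le_mul hT2 hT1 hT10 (by positivity)
  have hC : 0 ≤ 8 * A₁ * Real.log ((K : ℝ) + 2) := by positivity
  have hB'' := mul_le_mul_of_nonneg_left hB' hC
  nlinarith [hstep, hA, hB'', hC]

/-- (F1) LIQUID columns (pen §6 (F1)): if every column `k ∈ Lq ⊆ [1, K]`, `K ≤ n^σ`, is
liquid (every alive piece supplies `m_P d_P^k < λ n^ν`) and `2 c₀ n < n^ν`, then
`|Lq| · 2 ((1-λ) n^ν - 2 c₀ n) ≤ 2 n (n^β + b₁ n) + 16 A₁ n³ log (K+2)`. -/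
theorem liquid_count [DecidableEq ι] {c₀ β b₁ σ ν lam A₁ : ℝ} {n₀ : ℕ}
    (hW : D ∈ wellFormed c₀) (hc₀ : 0 ≤ c₀) (hB : D ∈ budgetLaw β b₁ n₀)
    (hS : D ∈ serviceLaw σ ν c₀ n₀) (hP : D ∈ pairLaw A₁) (hA₁ : 0 ≤ A₁) {n : ℕ}
    (hn : n₀ ≤ n) (hpos : 2 * c₀ * n < (n : ℝ) ^ ν) {K : ℕ} (hK : (K : ℝ) ≤ (n : ℝ) ^ σ)
    (Lq : Finset ℕ) (hLq : Lq ⊆ Finset.Icc 1 K)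
    (hliq : ∀ k ∈ Lq, ∀ P ∈ D.alive n, (D.mult P n : ℝ) * D.bank P k < lam * (n : ℝ) ^ ν) :
    (Lq.card : ℝ) * (2 * ((1 - lam) * (n : ℝ) ^ ν - 2 * c₀ * n)) ≤
      2 * n * ((n : ℝ) ^ β + b₁ * n) + 16 * A₁ * (n : ℝ) ^ 3 * Real.log ((K : ℝ) + 2) := by
  classical
  -- lower bound, column by column
  have hlow : (Lq.card : ℝ) * (2 * ((1 - lam) * (n : ℝ) ^ ν - 2 * c₀ * n)) ≤
      ∑ k ∈ Lq, ∑ P ∈ (D.alive n).filter (fun P => D.nearRoot P k = true ∧ 0 < D.bank P k),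
        ∑ Q ∈ ((D.alive n).filter
            (fun Q => D.nearRoot Q k = true ∧ 0 < D.bank Q k)).erase P,
          (D.mult P n : ℝ) * D.mult Q n * min (D.bank P k) (D.bank Q k) := by
    rw [← nsmul_eq_mul, ← Finset.sum_const]
    refine Finset.sum_le_sum fun k hk => ?_
    have hkI := Finset.mem_Icc.mp (hLq hk)
    exact D.liquid_column hW hc₀ hB hS hn hpos hkI.1 (le_trans (by exact_mod_cast hkI.2) hK)
      (hliq k hk) _ (fun P => Finset.mem_filter)
  -- exchange of summations
  have hcomm := soloX_sum_pairs_comm (D.alive n) Lq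
    (fun P k => D.nearRoot P k = true ∧ 0 < D.bank P k)
    (fun P Q k => (D.mult P n : ℝ) * D.mult Q n * min (D.bank P k) (D.bank Q k))
  -- upper bound, pair by pair
  have hup := D.pair_sum_le hW hB hP hA₁ hn K
    (fun P Q => Lq.filter (fun k => (D.nearRoot P k = true ∧ 0 < D.bank P k) ∧
      (D.nearRoot Q k = true ∧ 0 < D.bank Q k)))
    (fun P Q k hk => Finset.mem_Icc.mp (hLq (Finset.mem_filter.mp hk).1))
    (fun P Q k hk => (Finset.mem_filter.mp hk).2.1.1)
  have hmul : ∀ P Q, (D.mult P n : ℝ) * D.mult Q n *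
      ∑ k ∈ Lq.filter (fun k => (D.nearRoot P k = true ∧ 0 < D.bank P k) ∧
        (D.nearRoot Q k = true ∧ 0 < D.bank Q k)), min (D.bank P k) (D.bank Q k) =
      ∑ k ∈ Lq.filter (fun k => (D.nearRoot P k = true ∧ 0 < D.bank P k) ∧
        (D.nearRoot Q k = true ∧ 0 < D.bank Q k)),
        (D.mult P n : ℝ) * D.mult Q n * min (D.bank P k) (D.bank Q k) :=
    fun P Q => Finset.mul_sum _ _ _
  simp_rw [hmul] at hup
  exact (hlow.trans hcomm.symm.le).trans hup

end SoloServiceData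

end Summit.Schanuel.Schanuel.Theorems
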